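import Literature.NumberTheory.EllipticCurves.BurungaleCastellaSkinner2025.GreenbergMuInvariantGoodReduction
import Literature.NumberTheory.EllipticCurves.BurungaleCastellaSkinner2025.ProductDivisibilitiesIntegralityProofs
import Literature.NumberTheory.EllipticCurves.Rank1Residual.Predicates
import Summits.BirchSwinnertonDyer.Rank1Residual.Partition.IrreducibleOverQuadraticField
import HarnessLib

/-!
# Rational ⟹ integral on the anticyclotomic line, paid by the crux's own `μ(G⁻) = 0`
# (line `bdpline` v9 of crux `AnticyclotomicEisensteinDivisibility`, stmt-BirchSwinnertonDyer-20727)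

Helper file (`--supports stmt-BirchSwinnertonDyer-20727`) of the lead-prover seat bsd-line-sbc-p1 (gen 2),
line `bdpline`. The crux asks for the INTEGRAL inclusion `π(ch(X_Gr₂)^ur) ⊆ (G⁻)` in `𝒪_{ℂ_p}⟦T⟧`
(`𝒪 = 𝒪_{ℂ_p} = PadicComplexInt p`, `G⁻ = UnrSeries₂.minus G` the restriction of a two-variable Greenberg
`p`-adic `L`-function to the anticyclotomic line). Its antecedent `SignedTwoVariableInputs` carries, as
conjunct 1, the guarded fact `BurungaleCastellaSkinner2025.prop422_greenbergAnyRoot_hasUnitContent_minus`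
(BCS25 Prop. 4.2.2: `μ(G⁻) = 0` for every Katz/Greenberg frame with genuine period data). This file records
the three pieces of glue by which the skeleton's load-bearing stub S1 (Eisenstein half of the one-variable BDP
anticyclotomic main conjecture) may be weakened from its INTEGRAL to its RATIONAL form (`∃ k, p^k·𝔞 ⊆ (L)`):

* §1 `le_span_of_span_natCast_pow_mul_le_of_hasUnitContent` — ONE-variable cancellation over `𝒪_{ℂ_p}⟦T⟧`:
  `p^k·I ⊆ (L)` and `μ(L) = 0` ⟹ `I ⊆ (L)` (embed as `T₁`-constants into `𝒪_{ℂ_p}⟦T₂⟧⟦T₁⟧`, apply the tree's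
  two-variable cancellation `le_span_of_span_natCast_pow_mul_le_of_hasUnitContent_minus`, return along
  `constantCoeff ∘ C = id`; the embedding trick is the ideator bsd-idea-14's, `Cruxes/…/Lines/primkoly.lean`);
  membership form `le_span_of_forall_C_pow_mul_mem_of_hasUnitContent` matching the `∃ k, ∀ y ∈ 𝔞, C(p^k)·y ∈ (L)`
  shape of the staged child text `AnticyclotomicEisensteinDivisibilityRatSS`;
* §2 `hasUnitContent_minus_of_prop422` — under the crux's binders (`5 ≤ p` good, `Surj`, `K` imaginary quadratic
  with every `ℓ ∣ N` split = (Heeg), (spl), (disc), `(N, D_K) = 1`), conjunct 1 of the antecedent yields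
  `HasUnitContent (G⁻)` for every frame `(Ω ≠ 0, δ² = ±D_K, Ωp, LK, G)` — (irr_K) comes from `Surj` by
  `Rank1Residual.irrK_of_surj` (pattern of `SignedBaseChangeAcDivOfLowerHalf.acDivChild_of_greenbergLowerHalf`);
* §3 `le_span_minus_of_rat` — the composition step in one call: `μ(G⁻) = 0`, `(G⁻) = (M)` (S3 + frame
  rigidity), `𝔞 ⊆ 𝔟` (specialisation S2) and `∃ k, ∀ y ∈ 𝔟, C(p^k)·y ∈ (M)` (rational S1) give `𝔞 ⊆ (G⁻)`.

Pure algebra / hypothesis bookkeeping; nothing about elliptic curves is asserted; no new definitions.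
-/

-- D-0017: single-problem summit, the namespace repeats the problem name by design.
set_option linter.dupNamespace false
set_option autoImplicit false

noncomputable section

open scoped Classical

namespace Summit.BirchSwinnertonDyer.BirchSwinnertonDyer.Theorems.SignedBaseChangeAcDivRatToInt

open NumberField IsDedekindDomain Field CongruenceSubgroup
  Literature.NumberTheory.EllipticCurves Literature.NumberTheory.EllipticCurves.ModularForms
  Literature.NumberTheory.EllipticCurves.Rank1Residual Literature.NumberTheory.EllipticCurves.YanZhu2026
  Literature.NumberTheory.EllipticCurves.UnrSeries₂ Literature.NumberTheory.EllipticCurves.GreenbergVatsal2000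

variable {p : ℕ} [Fact p.Prime]

/-! ## §1. One-variable cancellation of a power of `p` against `μ = 0` over `𝒪_{ℂ_p}⟦T⟧` -/

/-- `constantCoeff ∘ C = id` on `𝒪_{ℂ_p}⟦T⟧ → 𝒪_{ℂ_p}⟦T⟧⟦T₁⟧ → 𝒪_{ℂ_p}⟦T⟧`. [folklore] -/
theorem constantCoeff_comp_C :
    (PowerSeries.constantCoeff (R := PowerSeries (PadicComplexInt p))).comp
      (PowerSeries.C (R := PowerSeries (PadicComplexInt p))) = RingHom.id _ := by
  ext x
  simp

/-- **`p^k·I ⊆ (L)` and `μ(L) = 0` ⟹ `I ⊆ (L)` in `𝒪_{ℂ_p}⟦T⟧** (one-variable Gauss-lemma cancellation):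
embed `𝒪_{ℂ_p}⟦T⟧ ↪ 𝒪_{ℂ_p}⟦T⟧⟦T₁⟧` as `T₁`-constants (`PowerSeries.C`), apply the tree's two-variable
cancellation `le_span_of_span_natCast_pow_mul_le_of_hasUnitContent_minus` (note `(C L)⁻ = L`), and return
along `constantCoeff ∘ C = id`. The embedding trick is bsd-idea-14's (`Cruxes/…/Lines/primkoly.lean`,
`Primkoly.le_span_of_span_pow_mul_le_of_hasUnitContent`). [folklore] -/
theorem le_span_of_span_natCast_pow_mul_le_of_hasUnitContent
    {L : PowerSeries (PadicComplexInt p)} (hL : HasUnitContent L)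
    {I : Ideal (PowerSeries (PadicComplexInt p))} {k : ℕ}
    (h : Ideal.span {((p : ℕ) : PowerSeries (PadicComplexInt p)) ^ k} * I ≤ Ideal.span {L}) :
    I ≤ Ideal.span {L} := by
  have hG : HasUnitContent (minus (PowerSeries.C (R := PowerSeries (PadicComplexInt p)) L)) := by
    simpa [minus] using hL
  have h2 : Ideal.span {((p : ℕ) : PowerSeries (PowerSeries (PadicComplexInt p))) ^ k} *
      I.map (PowerSeries.C (R := PowerSeries (PadicComplexInt p))) ≤
      Ideal.span {PowerSeries.C (R := PowerSeries (PadicComplexInt p)) L} := by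
    have h' := Ideal.map_mono (f := PowerSeries.C (R := PowerSeries (PadicComplexInt p))) h
    rwa [Ideal.map_mul, Ideal.map_span, Set.image_singleton, Ideal.map_span, Set.image_singleton, map_pow,
      map_natCast] at h'
  have h3 := le_span_of_span_natCast_pow_mul_le_of_hasUnitContent_minus hG h2
  have h4 := Ideal.map_mono (f := PowerSeries.constantCoeff (R := PowerSeries (PadicComplexInt p))) h3
  rwa [Ideal.map_map, constantCoeff_comp_C, Ideal.map_id, Ideal.map_span, Set.image_singleton,
    PowerSeries.constantCoeff_C] at h4

/-- Membership form of the cancellation, matching the shape `∃ k, ∀ y ∈ 𝔞, C(p^k)·y ∈ (L)` of the staged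
child text `AnticyclotomicEisensteinDivisibilityRatSS`: if every `y ∈ I` has `C(p^k)·y ∈ (L)` and
`μ(L) = 0` then `I ⊆ (L)`. [folklore] -/
theorem le_span_of_forall_C_pow_mul_mem_of_hasUnitContent
    {L : PowerSeries (PadicComplexInt p)} (hL : HasUnitContent L)
    {I : Ideal (PowerSeries (PadicComplexInt p))} {k : ℕ}
    (h : ∀ y ∈ I, PowerSeries.C (((p : ℕ) : PadicComplexInt p) ^ k) * y ∈ Ideal.span {L}) :
    I ≤ Ideal.span {L} := by
  refine le_span_of_span_natCast_pow_mul_le_of_hasUnitContent hL (k := k) ?_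
  rw [Ideal.span_singleton_mul_le_iff]
  intro y hy
  have e : ((p : ℕ) : PowerSeries (PadicComplexInt p)) ^ k = PowerSeries.C (((p : ℕ) : PadicComplexInt p) ^ k) := by
    rw [map_pow, map_natCast]
  rw [e]
  exact h y hy

/-! ## §2. `μ(G⁻) = 0` under the crux's binders, from conjunct 1 of its antecedent -/

/-- **`μ(G⁻) = 0` from the guarded fact BCS25 Prop. 4.2.2 under the binders of crux
`AnticyclotomicEisensteinDivisibility`**: good `p ≥ 5`, `Surj W p` (⟹ (irr_K) over the imaginary quadratic
`K` by `Rank1Residual.irrK_of_surj`), every `ℓ ∣ N` split in `K` (= `SatisfiesHeegnerHypothesis N K`), (spl)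
`p = v·v̄`, (disc), `(N, D_K) = 1`, the (cyclotomic, anticyclotomic) tower, and a Katz/Greenberg frame with
genuine period data. [cite: BurungaleCastellaSkinner2025, Prop. 4.2.2 (§4.2, p. 9 L2–L13 of arXiv:2405.00270v2)] -/
theorem hasUnitContent_minus_of_prop422
    (h422 : BurungaleCastellaSkinner2025.prop422_greenbergAnyRoot_hasUnitContent_minus)
    (W : WeierstrassCurve ℚ) [W.IsElliptic] [W.IsGloballyMinimal] (hp : 5 ≤ p)
    (hgood : W.HasGoodReductionAtPrime p) (hs : Surj W p) (K : Type) [Field K] [NumberField K]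
    (ι : PadicAlgCl p ≃+* ℂ) (v vbar : HeightOneSpectrum (𝓞 K)) (κ₁ κ₂ : ZpExtension K p)
    (γ₁ γ₂ : absoluteGaloisGroup K) [Fact (ZpExtension.IsTopGeneratorPair κ₁ κ₂ γ₁ γ₂)]
    [NeZero (NumberField.discr K).natAbs] {N : ℕ} [NeZero N] {f : CuspForm (Gamma0 N) 2}
    (hf : IsNewformOf W f) (hN : (N : ℤ) = W.conductorNorm ℤ) (hK : IsImaginaryQuadratic K)
    (hsplit : ((Ideal.span {(p : ℤ)}).primesOver (𝓞 K)).ncard = 2)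
    (hv : ((p : ℕ) : 𝓞 K) ∈ v.asIdeal) (hvbar : ((p : ℕ) : 𝓞 K) ∈ vbar.asIdeal) (hvv : vbar ≠ v)
    (hι : ∀ (w : InfinitePlace K) (k : 𝓞 K), k ∈ v.asIdeal ↔ ‖ι.symm (w.embedding (k : K))‖ < 1)
    (hcop : IsCoprime (N : ℤ) (NumberField.discr K))
    (hHeeg : ∀ ℓ : ℕ, ℓ.Prime → ℓ ∣ N → ((Ideal.span {(ℓ : ℤ)}).primesOver (𝓞 K)).ncard = 2)
    (hodd : Odd (NumberField.discr K)) (hne3 : NumberField.discr K ≠ -3)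
    (hκ₁ : κ₁.IsCyclotomic) (hκ₂ : κ₂.IsAnticyclotomic)
    {Ω δ : ℂ} {Ωp : (unrIntegers p)ˣ} {LK G : PowerSeries (PowerSeries (PadicComplexInt p))}
    (hΩ : Ω ≠ 0) (hδ : δ ^ 2 = (NumberField.discr K : ℂ) ∨ δ ^ 2 = -(NumberField.discr K : ℂ))
    (hLK : IsKatzMeasure₂ ι v vbar ∅ κ₁ κ₂ γ₁⁻¹ γ₂⁻¹ 1 Ω δ ((Ωp : unrIntegers p) : PadicComplex p) LK)
    (hG : IsGreenbergLFunctionAnyRoot₂ ι v vbar κ₁ κ₂ γ₁⁻¹ γ₂⁻¹ f (NumberField.discr K).natAbs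
      (NumberField.classNumber K) LK G) :
    HasUnitContent (minus G) :=
  have hirr : (W.baseChange K).HasIrreducibleModPGaloisRep p :=
    Summit.BirchSwinnertonDyer.Rank1Residual.irrK_of_surj W p hs K hK.1
  h422 ι W K v vbar κ₁ κ₂ γ₁ γ₂ hf hN (by omega) hgood hK hHeeg hsplit hodd hne3 hcop hirr hv hvbar hvv hι
    hκ₁ hκ₂ Ω δ Ωp LK G hΩ hδ hLK hG

/-! ## §3. The composition step: rational S1 + specialisation + S3/rigidity + `μ(G⁻) = 0` ⟹ the crux's inclusion -/

/-- **Rational ⟹ integral on the anticyclotomic line.** If `μ(G⁻) = 0`, `(G⁻) = (M)` (S3: `G⁻` is a BDP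
`L`-function, read in a rigid frame), `𝔞 ⊆ 𝔟` (S2: the specialised two-variable characteristic ideal inside
the one-variable one) and `∃ k, ∀ y ∈ 𝔟, C(p^k)·y ∈ (M)` (S1-rat: the RATIONAL Eisenstein half), then
`𝔞 ⊆ (G⁻)` — the conclusion of the crux. [folklore] -/
theorem le_span_minus_of_rat {G : PowerSeries (PowerSeries (PadicComplexInt p))}
    (hμ : HasUnitContent (minus G)) {M : PowerSeries (PadicComplexInt p)}
    (hGM : Ideal.span {minus G} = Ideal.span {M}) {𝔞 𝔟 : Ideal (PowerSeries (PadicComplexInt p))}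
    (hab : 𝔞 ≤ 𝔟) (hk : ∃ k : ℕ, ∀ y ∈ 𝔟, PowerSeries.C (((p : ℕ) : PadicComplexInt p) ^ k) * y ∈ Ideal.span {M}) :
    𝔞 ≤ Ideal.span {minus G} := by
  obtain ⟨k, hk⟩ := hk
  refine le_span_of_forall_C_pow_mul_mem_of_hasUnitContent hμ (k := k) fun y hy ↦ ?_
  rw [hGM]
  exact hk y (hab hy)

end Summit.BirchSwinnertonDyer.BirchSwinnertonDyer.Theorems.SignedBaseChangeAcDivRatToInt

end
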